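import Mathlib

/-!
# `ConeLocalisation` (stmt-AtomisticToContinuum-12504): removing the density floor is not logic
# (schema non-entailment, explicit witness)

Negative helper file of the standing crux disprover (`Cruxes/ConeLocalisation/Disproof.lean` §3;
refuter-cdisprove-stmt-AtomisticToContinuum-12504-0, 2026-08-17). Pure logic over `ℝ`; no Theses
declaration is mentioned.

The ideators' repair of the crux inserts a density floor `M⁻¹ ≤ ρ s x` into the guards of `S` (the
consequent of `ConeLocalisation` = the antecedent of `RestartPrinciple`), giving `S♭`. Trivially `S → S♭`.
The converse `S♭ → S` is NOT a matter of logic even though every individual classical solution has SOME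
positive density floor on the compact slab `[0, t] × 𝕋³`: the horizon `τ₁` of `S` may depend on the guard
level `M` only, so `S` needs a horizon UNIFORM in the floor, i.e. genuine hydrodynamics of low-density
layers. Abstracting a datum to its floor value `m > 0` and "the LLN holds at time `t`" to `L m t`:

* `floorRemoval_schema_false` — `(∀ M > 0, ∃ τ₁ > 0, ∀ m ≥ M⁻¹, ∀ t ∈ [0, τ₁), L m t)` does not entail
  `(∀ M > 0, ∃ τ₁ > 0, ∀ m > 0, ∀ t ∈ [0, τ₁), L m t)`; witness `L m t := t < m` (the LLN holds up to a
  time equal to the floor — the caricature of a rarefied layer whose local mean free time is long).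

Consequence for planners: floor BOTH copies of `S` (stmt-12504's consequent and stmt-12503's antecedent)
or neither — flooring only the glue's consequent would leave `closes` needing exactly the non-entailed
step. Consequence for provers: a proof of the floored glue is not a proof of the filed one.
-/

namespace Summit.AtomisticToContinuum.HydrodynamicLimit.Theorems.ConeLocalisationNegative

/-- **Floor removal is not logic** (schema, explicit witness `L m t := t < m`). [folklore] -/
theorem floorRemoval_schema_false :
    ¬ ∀ L : ℝ → ℝ → Prop,
      (∀ M : ℝ, 0 < M → ∃ τ₁ : ℝ, 0 < τ₁ ∧ ∀ m : ℝ, M⁻¹ ≤ m → ∀ t ∈ Set.Ico (0:ℝ) τ₁, L m t) →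
      (∀ M : ℝ, 0 < M → ∃ τ₁ : ℝ, 0 < τ₁ ∧ ∀ m : ℝ, 0 < m → ∀ t ∈ Set.Ico (0:ℝ) τ₁, L m t) := by
  intro h
  have hfl : ∀ M : ℝ, 0 < M → ∃ τ₁ : ℝ, 0 < τ₁ ∧
      ∀ m : ℝ, M⁻¹ ≤ m → ∀ t ∈ Set.Ico (0:ℝ) τ₁, t < m :=
    fun M hM => ⟨M⁻¹, inv_pos.2 hM, fun m hm t ht => lt_of_lt_of_le ht.2 hm⟩
  obtain ⟨τ₁, hτ₁, H⟩ := h (fun m t => t < m) hfl 1 one_pos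
  have := H (τ₁ / 2) (by positivity) (τ₁ / 2) ⟨by positivity, by linarith⟩
  linarith

/-- The same with the floor-free side weakened to any FIXED floor-uniform horizon: for no `τ₁ > 0` does
the floored schema yield `L m t` for all `m > 0`, `t ∈ [0, τ₁)` (witness as above). [folklore] -/
theorem floorUniformHorizon_schema_false (τ₁ : ℝ) (hτ₁ : 0 < τ₁) :
    ¬ ∀ L : ℝ → ℝ → Prop,
      (∀ M : ℝ, 0 < M → ∃ τ : ℝ, 0 < τ ∧ ∀ m : ℝ, M⁻¹ ≤ m → ∀ t ∈ Set.Ico (0:ℝ) τ, L m t) →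
      ∀ m : ℝ, 0 < m → ∀ t ∈ Set.Ico (0:ℝ) τ₁, L m t := by
  intro h
  have hfl : ∀ M : ℝ, 0 < M → ∃ τ : ℝ, 0 < τ ∧
      ∀ m : ℝ, M⁻¹ ≤ m → ∀ t ∈ Set.Ico (0:ℝ) τ, t < m :=
    fun M hM => ⟨M⁻¹, inv_pos.2 hM, fun m hm t ht => lt_of_lt_of_le ht.2 hm⟩
  have := h (fun m t => t < m) hfl (τ₁ / 2) (by positivity) (τ₁ / 2) ⟨by positivity, by linarith⟩
  linarith

/-- Whereas WITH a floor-dependent level the floored schema does give every individual datum its own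
horizon (the trivial direction, recorded for contrast: this is all that `S♭` offers a fixed solution).
[folklore] -/
theorem floored_schema_pointwise (L : ℝ → ℝ → Prop)
    (h : ∀ M : ℝ, 0 < M → ∃ τ : ℝ, 0 < τ ∧ ∀ m : ℝ, M⁻¹ ≤ m → ∀ t ∈ Set.Ico (0:ℝ) τ, L m t)
    (m : ℝ) (hm : 0 < m) : ∃ τ : ℝ, 0 < τ ∧ ∀ t ∈ Set.Ico (0:ℝ) τ, L m t := by
  obtain ⟨τ, hτ, H⟩ := h m⁻¹ (inv_pos.2 hm)
  exact ⟨τ, hτ, fun t ht => H m (by rw [inv_inv]) t ht⟩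

end Summit.AtomisticToContinuum.HydrodynamicLimit.Theorems.ConeLocalisationNegative
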